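import Summits.CriticalPhenomena.SAWScalingLimit.Theorems.SAWLoopFugacityFlowIsingBoundaryRatioWindowCrossingGeom
import Summits.CriticalPhenomena.SAWScalingLimit.Theorems.SAWLoopFugacityFlowIsingBoundaryRatioWindowCrossingSegments
import Summits.CriticalPhenomena.SAWScalingLimit.Theorems.SAWLoopFugacityFlowIsingBoundaryRatioWindowRectSucc
import HarnessLib

/-!
# Radial crossings pass through the window rectangle (`AnnCrossThroughWindowRect`, PROVED)
(line `fk-anchor-transfer`, crux `IsingBoundaryRatio`, stmt-CriticalPhenomena-10650; registered stub
`annCrossThroughWindowRect_holds` of the rim-to-rim instance of CDH16 Thm 1.1 (ii))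

For the chordal chart `φ` of `(D; a, b)`, `M > 1`, `ε > 0`, scales `ρ < ρ₀`, radii
`ρ < r₁ < r₁' < r₂' < r₂ < Mρ`, small `δ`, a finite volume `Λ` agreeing locally with `Ω_δ` and containing the
chart disc of radius `Mρ`, and ANY presentation `IsWindowRect … E d₀ n` of the window as a discrete rectangle:
an `ω`-open radial crossing `AnnCross` of the annulus contains an `ω`-open walk of `⟨E⟩` from a vertex of arc `1`
to a vertex of arc `3`.

Proof.
* (closedness) For small `δ` the chart values of adjacent sites differ by less than the margins
  (`windowBand_geometry`, first clause), so `IsWindowRect.closed` says: every `Ω_δ`-edge at a vertex of `E` of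
  band radius `[r₁', r₂']` towards a site of `Λ` is in `E`.
* (A: band crossings meet `E`) `windowBand_geometry` supplies a chain `𝒬` of perfect cells at mid-band radius,
  sharing-connected from a cell `Q₀` in the cone, met by every walk of `Ω_δ` across the band at a corner; the
  corners of `Q₀` are vertices of `E` (`bulk_mem`), and closedness along the sides of the cells propagates this
  to every corner of the chain; so a band crossing has a vertex of `E` inside the open band.
* (B: segments) `exists_inner_outer_segment`: the crossing, from `a` (radius `≤ ρ`, not a vertex of `E`) to `b`
  (radius `≥ Mρ`, not a vertex of `E`), contains a sub-walk with all edges in `E` from an inner rim vertex `u`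
  (a vertex of `E` of radius `< r₁'` with an `Ω_δ`-edge to `Λ` off `E`) to an outer rim vertex `v`.
* (C: arcs) the missing edges at `u`, `v` are external darts of `E` (`WindowRect.exists_eq_add_dir_of_adj` of
  `…WindowRectSucc.lean`), on the boundary cycle (`IsRect.cover`), and
  `IsWindowRect.rim_darts` puts them on the arcs `1` and `3` (or `3` and `1`: reverse the walk).
-/

noncomputable section

open scoped Classical Topology
open Filter Set Metric SimpleGraph Complex
open Literature.Probability.LatticeModels Literature.Probability.RandomPlanarGeometry
open Literature.Probability.Percolation (BondConfig)
open Literature.Topology.PlaneTopology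
open UpperHalfPlane (upperHalfPlaneSet)

namespace Summit.CriticalPhenomena.SAWScalingLimit.Theorems.IsingBoundaryRatio

set_option maxHeartbeats 4000000 in
/-- **Radial crossings pass through the window rectangle** (`AnnCrossThroughWindowRect`; see the module
docstring). [folklore] -/
theorem annCrossThroughWindowRect_holds : AnnCrossThroughWindowRect := by
  intro D φ hφ M hM ε hε
  obtain ⟨ρ₀, hρ₀, hgeom⟩ := windowBand_geometry D φ hφ M hM ε hε
  refine ⟨ρ₀, hρ₀, fun ρ hρ hρ₀' r₁ r₁' r₂' r₂ h01 h1 h12 h2 h2M => ?_⟩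
  have hm0 : 0 < min (r₁' - r₁) (r₂ - r₂') := lt_min (by linarith) (by linarith)
  have hm1 : min (r₁' - r₁) (r₂ - r₂') ≤ r₁' - r₁ := min_le_left _ _
  have hm2 : min (r₁' - r₁) (r₂ - r₂') ≤ r₂ - r₂' := min_le_right _ _
  obtain ⟨hinball, hev⟩ := hgeom ρ hρ hρ₀' r₁' r₂' (min (r₁' - r₁) (r₂ - r₂')) (by linarith) h12 (by linarith) hm0
  filter_upwards [hev, self_mem_nhdsWithin] with δ hδ hδpos Λ hLA hdisc E d₀ n hE
  obtain ⟨hcont, 𝒬, Q₀, hQ₀, hcells, hcone, hconn, hcross⟩ := hδ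
  have hδ0 : 0 < δ := hδpos
  intro H ω hcr
  obtain ⟨a, b, W, ha, hb, -, hopen⟩ := hcr
  have hadj : ∀ {x y : Λ}, H.Adj x y → (discreteDomainGraph D.carrier δ).Adj x.1 y.1 := fun h => h
  -- vertices of `E`: in `Λ`, in the window
  have hvertsE : ∀ x ∈ DiscreteRect.verts E, ∃ hx : x ∈ Λ, meshPoint δ x ∈ ball (D.pt 0) ε ∧
      ρ < ‖φ.symm (meshPoint δ x)‖ ∧ ‖φ.symm (meshPoint δ x)‖ < M * ρ ∧ r₁ ≤ ‖φ.symm (meshPoint δ x)‖ ∧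
      ‖φ.symm (meshPoint δ x)‖ ≤ r₂ := by
    intro x hx
    obtain ⟨e, he, hxe⟩ := mem_verts_iff.1 hx
    obtain ⟨hxΛ, ⟨hball, hρx, hxM⟩, hx₁, hx₂⟩ := hE.mem_window e he x hxe
    exact ⟨hxΛ, hball, hρx, hxM, hx₁, hx₂⟩
  -- closedness along the band, for `Ω_δ`-edges towards sites of `Λ`
  have RC : ∀ x y : Λ, x.1 ∈ DiscreteRect.verts E → r₁' ≤ ‖φ.symm (meshPoint δ x.1)‖ →
      ‖φ.symm (meshPoint δ x.1)‖ ≤ r₂' → H.Adj x y → s(x.1, y.1) ∈ E := by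
    intro x y hx h1x h2x hxy
    refine hE.closed x.1 y.1 y.2 hx h1x h2x (hadj hxy) ?_
    obtain ⟨-, -, -, hxM, -, -⟩ := hvertsE x.1 hx
    obtain ⟨hmg, hxmd, hymd⟩ := discreteDomainGraph_adj_iff.1 (hadj hxy)
    have hxD := meshDomain_subset_meshVertices _ _ hxmd
    have hyD := meshDomain_subset_meshVertices _ _ hymd
    have hdist := hcont x.1 y.1 hmg hxD hyD hxM.le
    rw [dist_eq_norm] at hdist
    have hlo := norm_sub_norm_le (φ.symm (meshPoint δ x.1)) (φ.symm (meshPoint δ y.1))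
    have hhi := norm_sub_norm_le (φ.symm (meshPoint δ y.1)) (φ.symm (meshPoint δ x.1))
    rw [norm_sub_rev] at hlo
    have hy1 : r₁ ≤ ‖φ.symm (meshPoint δ y.1)‖ := by linarith
    have hy2 : ‖φ.symm (meshPoint δ y.1)‖ ≤ r₂ := by linarith
    exact ⟨⟨hinball _ hyD (by linarith), by linarith, by linarith⟩, hy1, hy2⟩
  -- (A) every corner of the chain is a vertex of `E`
  have hQverts : ∀ Q ∈ 𝒬, ∀ a b : Bool, Mesh.corner Q.1 Q.2 a b ∈ DiscreteRect.verts E := by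
    refine hconn {Q | ∀ a b : Bool, Mesh.corner Q.1 Q.2 a b ∈ DiscreteRect.verts E} ?_ ?_
    · intro a b
      obtain ⟨hmd, hball', h1', h2'⟩ := (hcells Q₀ hQ₀).2 a b
      have hΛ : Mesh.corner Q₀.1 Q₀.2 a b ∈ Λ := hdisc _ hmd (by linarith)
      exact hE.bulk_mem _ hΛ hmd ⟨⟨hball', by linarith, by linarith⟩, h1'.le, h2'.le⟩ (hcone a b)
    · rintro Q - hQS Q' hQ' ⟨a, b, a', b', hab⟩
      have hκ : Mesh.corner Q'.1 Q'.2 a' b' ∈ DiscreteRect.verts E := hab ▸ hQS a b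
      obtain ⟨hperf', hc'⟩ := hcells Q' hQ'
      have step : ∀ a₁ b₁ a₂ b₂ : Bool,
          (meshGraph D.carrier δ).Adj (Mesh.corner Q'.1 Q'.2 a₁ b₁) (Mesh.corner Q'.1 Q'.2 a₂ b₂) →
          Mesh.corner Q'.1 Q'.2 a₁ b₁ ∈ DiscreteRect.verts E →
          Mesh.corner Q'.1 Q'.2 a₂ b₂ ∈ DiscreteRect.verts E := by
        intro a₁ b₁ a₂ b₂ hadj' h1
        obtain ⟨hmd1, -, hr1, hr1'⟩ := hc' a₁ b₁
        obtain ⟨hmd2, -, -, hr2'⟩ := hc' a₂ b₂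
        have hΛ1 : Mesh.corner Q'.1 Q'.2 a₁ b₁ ∈ Λ := hdisc _ hmd1 (by linarith)
        have hΛ2 : Mesh.corner Q'.1 Q'.2 a₂ b₂ ∈ Λ := hdisc _ hmd2 (by linarith)
        have hE2 := RC ⟨_, hΛ1⟩ ⟨_, hΛ2⟩ h1 hr1.le hr1'.le (discreteDomainGraph_adj_iff.2 ⟨hadj', hmd1, hmd2⟩)
        exact (mem_verts_of_mem hE2).2
      have hh : ∀ a₁ a₂ b₀ : Bool, Mesh.corner Q'.1 Q'.2 a₁ b₀ ∈ DiscreteRect.verts E →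
          Mesh.corner Q'.1 Q'.2 a₂ b₀ ∈ DiscreteRect.verts E := by
        intro a₁ a₂ b₀ h
        cases a₁ <;> cases a₂
        · exact h
        · exact step _ _ _ _ (hperf'.1.meshGraph_adj_horizontal hδ0 b₀) h
        · exact step _ _ _ _ (hperf'.1.meshGraph_adj_horizontal hδ0 b₀).symm h
        · exact h
      have hv : ∀ a₀ b₁ b₂ : Bool, Mesh.corner Q'.1 Q'.2 a₀ b₁ ∈ DiscreteRect.verts E →
          Mesh.corner Q'.1 Q'.2 a₀ b₂ ∈ DiscreteRect.verts E := by
        intro a₀ b₁ b₂ h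
        cases b₁ <;> cases b₂
        · exact h
        · exact step _ _ _ _ (hperf'.1.meshGraph_adj_vertical hδ0 a₀) h
        · exact step _ _ _ _ (hperf'.1.meshGraph_adj_vertical hδ0 a₀).symm h
        · exact h
      intro a'' b''
      exact hv _ _ _ (hh _ _ _ hκ)
  -- (A) band crossings meet `E` inside the open band
  have bandA : ∀ (p q : Λ) (Z : H.Walk p q), ‖φ.symm (meshPoint δ p.1)‖ ≤ r₁' →
      r₂' ≤ ‖φ.symm (meshPoint δ q.1)‖ → (∀ dd ∈ Z.darts, ‖φ.symm (meshPoint δ dd.fst.1)‖ < r₂') →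
      ∃ z ∈ Z.support, z.1 ∈ DiscreteRect.verts E ∧ r₁' < ‖φ.symm (meshPoint δ z.1)‖ ∧
        ‖φ.symm (meshPoint δ z.1)‖ < r₂' := by
    intro p q Z hp hq hZ
    set f := SimpleGraph.Hom.comap (Subtype.val : Λ → Site 2) (discreteDomainGraph D.carrier δ) with hf
    have hZd : ∀ e ∈ (Z.map f).darts, ‖φ.symm (meshPoint δ e.fst)‖ < M * ρ := by
      intro e he
      rw [Walk.darts_map, List.mem_map] at he
      obtain ⟨dd, hdd, rfl⟩ := he
      exact (hZ dd hdd).trans (by linarith)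
    have hZs : ∀ z ∈ (Z.map f).support, ∃ z' ∈ Z.support, f z' = z := by
      intro z hz
      rwa [Walk.support_map, List.mem_map] at hz
    obtain ⟨Q, hQ, z, hz, a', b', hzc⟩ := hcross p.1 q.1 (Z.map f) hp hq hZd
    obtain ⟨z', hz', rfl⟩ := hZs z hz
    obtain ⟨-, -, h1', h2'⟩ := (hcells Q hQ).2 a' b'
    have hzc' : z'.1 = Mesh.corner Q.1 Q.2 a' b' := hzc
    refine ⟨z', hz', ?_, ?_, ?_⟩ <;> rw [hzc']
    exacts [hQverts Q hQ a' b', h1', h2']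
  -- the crossing `W : a → b`
  obtain ⟨haball, haρ⟩ := ha
  have har : ‖φ.symm (meshPoint δ a.1)‖ < r₁' := by linarith
  have haE : a.1 ∉ DiscreteRect.verts E := fun h => by
    obtain ⟨-, -, -, -, h1', -⟩ := hvertsE a.1 h
    linarith
  have hab : a ≠ b := fun h => hb (Or.inl (h ▸ ⟨haball, haρ⟩))
  cases W with
  | nil => exact absurd rfl hab
  | @cons _ y _ hay W' =>
  have hbmd : b.1 ∈ meshDomain D.carrier δ := by
    obtain ⟨dl, -, hdlb⟩ := exists_dart_snd_eq (Walk.cons hay W') (by simp)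
    have := (discreteDomainGraph_adj_iff.1 (hadj dl.adj)).2.2
    rwa [hdlb] at this
  have hbM : M * ρ ≤ ‖φ.symm (meshPoint δ b.1)‖ := by
    by_contra h
    push Not at h
    have hbball := hinball _ (meshDomain_subset_meshVertices _ _ hbmd) h
    rcases le_or_gt ‖φ.symm (meshPoint δ b.1)‖ ρ with h' | h'
    · exact hb (Or.inl ⟨hbball, h'⟩)
    · exact hb (Or.inr ⟨hbball, h', h⟩)
  have hbr : r₂' ≤ ‖φ.symm (meshPoint δ b.1)‖ := by linarith
  have hbE : b.1 ∉ DiscreteRect.verts E := fun h => by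
    obtain ⟨-, -, -, -, -, h2'⟩ := hvertsE b.1 h
    linarith
  have hayE : s(a.1, y.1) ∉ E := fun h => haE (mem_verts_of_mem h).1
  -- (B) the inner-to-outer `E`-segment
  obtain ⟨u, v, P, huE, hur, ⟨u', huu', huu'E⟩, hvE, hvr, ⟨v', hvv', hvv'E⟩, hPW, hPE⟩ :=
    exists_inner_outer_segment H E (fun z : Λ => ‖φ.symm (meshPoint δ z.1)‖) h12 RC bandA hbr hbE a y hay W'
      har hayE
  -- (C) rim darts lie on the arcs `1` / `3`
  have hdart : ∀ (w w' : Λ), w.1 ∈ DiscreteRect.verts E → H.Adj w w' → s(w.1, w'.1) ∉ E →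
      ∃ i < n 0 + n 1 + n 2 + n 3, ((DiscreteRect.succ E)^[i] d₀).1 = w.1 ∧
        (discreteDomainGraph D.carrier δ).Adj ((DiscreteRect.succ E)^[i] d₀).1
          (((DiscreteRect.succ E)^[i] d₀).1 + DiscreteRect.dir ((DiscreteRect.succ E)^[i] d₀).2) ∧
        ((DiscreteRect.succ E)^[i] d₀).1 + DiscreteRect.dir ((DiscreteRect.succ E)^[i] d₀).2 ∈ Λ := by
    intro w w' hw hww' hnot
    have hzd := (meshGraph_adj_iff.1 (discreteDomainGraph_adj_iff.1 (hadj hww')).1).1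
    obtain ⟨k, hk⟩ := WindowRect.exists_eq_add_dir_of_adj hzd
    obtain ⟨i, hi, heq⟩ := hE.isRect.cover (w.1, k) ⟨hw, by rw [← hk]; exact hnot⟩
    refine ⟨i, hi, by rw [heq], ?_, ?_⟩
    · rw [heq]; show (discreteDomainGraph D.carrier δ).Adj w.1 (w.1 + DiscreteRect.dir k)
      rw [← hk]; exact hadj hww'
    · rw [heq]; show w.1 + DiscreteRect.dir k ∈ Λ
      rw [← hk]; exact w'.2
  -- the output, for either assignment of the rims to the arcs `1`, `3`
  have finish : ∀ (u₀ v₀ : Λ) (P₀ : H.Walk u₀ v₀), u₀.1 ∈ DiscreteRect.arcVerts E d₀ n 1 →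
      v₀.1 ∈ DiscreteRect.arcVerts E d₀ n 3 → (∀ e ∈ P₀.edges, e ∈ (Walk.cons hay W').edges) →
      (∀ e ∈ P₀.edges, Sym2.map Subtype.val e ∈ E) →
      ∃ (u v : Site 2), u ∈ DiscreteRect.arcVerts E d₀ n 1 ∧ v ∈ DiscreteRect.arcVerts E d₀ n 3 ∧
        ∃ p : (SimpleGraph.fromEdgeSet (↑E : Set (Sym2 (Site 2)))).Walk u v,
          ∀ e ∈ p.edges, ∃ (x y : Site 2) (hx : x ∈ Λ) (hy : y ∈ Λ),
            e = s(x, y) ∧ s((⟨x, hx⟩ : ↥Λ), ⟨y, hy⟩) ∈ ω := by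
    intro u₀ v₀ P₀ hu₀ hv₀ hP₀W hP₀E
    set P₁ := P₀.map (SimpleGraph.Hom.comap (Subtype.val : Λ → Site 2) (discreteDomainGraph D.carrier δ))
      with hP₁
    have hP₁e : ∀ e ∈ P₁.edges, ∃ e' ∈ P₀.edges, Sym2.map Subtype.val e' = e := fun e he => by
      rw [hP₁, Walk.edges_map, List.mem_map] at he
      exact he
    have htr : ∀ e ∈ P₁.edges, e ∈ (SimpleGraph.fromEdgeSet (↑E : Set (Sym2 (Site 2)))).edgeSet := by
      intro e he
      obtain ⟨e', he', rfl⟩ := hP₁e e he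
      rw [edgeSet_fromEdgeSet]
      refine ⟨hP₀E e' he', fun h => ?_⟩
      rw [Sym2.mem_diagSet] at h
      exact (discreteDomainGraph D.carrier δ).not_isDiag_of_mem_edgeSet (P₁.edges_subset_edgeSet he) h
    set P₂ := P₁.transfer _ htr with hP₂
    have hP₂e : ∀ e ∈ P₂.edges, e ∈ P₁.edges := fun e he => by rwa [hP₂, Walk.edges_transfer] at he
    refine ⟨u₀.1, v₀.1, hu₀, hv₀, P₂, fun e he => ?_⟩
    obtain ⟨e', he', rfl⟩ := hP₁e e (hP₂e e he)
    have hopen' := hopen e' (hP₀W e' he')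
    revert he' hopen'
    refine Sym2.ind (fun x y _ hxy => ?_) e'
    exact ⟨x.1, y.1, x.2, y.2, by rw [Sym2.map_mk], hxy⟩
  rcases hE.rim_darts with hrim | hrim
  · obtain ⟨i, hi, hiu, hai, hΛi⟩ := hdart u u' huE huu' huu'E
    obtain ⟨j, hj, hjv, haj, hΛj⟩ := hdart v v' hvE hvv' hvv'E
    have hu₁ := (hrim i hi hai hΛi).1 (by rw [hiu]; exact hur)
    have hv₃ := (hrim j hj haj hΛj).2 (by rw [hjv]; exact hvr)
    exact finish u v P ⟨i, hu₁.1, hu₁.2, hiu⟩ ⟨j, hv₃.1, hv₃.2, hjv⟩ hPW hPE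
  · obtain ⟨i, hi, hiu, hai, hΛi⟩ := hdart u u' huE huu' huu'E
    obtain ⟨j, hj, hjv, haj, hΛj⟩ := hdart v v' hvE hvv' hvv'E
    have hu₃ := (hrim i hi hai hΛi).1 (by rw [hiu]; exact hur)
    have hv₁ := (hrim j hj haj hΛj).2 (by rw [hjv]; exact hvr)
    exact finish v u P.reverse ⟨j, hv₁.1, hv₁.2, hjv⟩ ⟨i, hu₃.1, hu₃.2, hiu⟩
      (fun e he => hPW e (by rwa [Walk.edges_reverse, List.mem_reverse] at he))
      (fun e he => hPE e (by rwa [Walk.edges_reverse, List.mem_reverse] at he))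

end Summit.CriticalPhenomena.SAWScalingLimit.Theorems.IsingBoundaryRatio

end
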